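import Summits.CriticalPhenomena.CardyFormulaZ2.Theses.CardyComplexCone
import Literature.Probability.LatticeModels.MedialInterfaceProofs
import Literature.Probability.LatticeModels.ExplorationWinding
import Literature.Probability.LatticeModels.MedialWindingBridge
import Literature.Probability.LatticeModels.DartPhase

/-!
# Disproof of `EdgePrecompact` (stmt-CriticalPhenomena-11387) — findings of the standing adversary

Crux (route `CardyComplexCone`, rank 3, XL; decl
`Summit.CriticalPhenomena.CardyFormulaZ2.Theses.CardyComplexCone.EdgePrecompact`): for every
Dobrushin domain `D`, every discretisation family `Λ` (`(Λ δ).Ω = D.carrier`, `(Λ δ).δ = δ`,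
eventually `ℤ²`-admissible) and every compact `K ⊆ D.carrier`:
(i) `∃ C, ∀ᶠ δ, ‖E_δ(v,f)‖ ≤ C·δ^{1/3}` for all corners `(v,f)` with `δv ∈ K`;
(ii) `∀ ε ∃ η ∀ᶠ δ`, corners of the SAME class (`f - v = f' - v'`) in `K` at distance `< η` have
`‖E_δ(v,f) - E_δ(v',f')‖ ≤ ε·δ^{1/3}`.
Here `E_δ(v,f) = cornerObs (Λ δ) δ v f` (below; `edgePrecompact_iff` is `Iff.rfl`) is the
spin-`1/3` corner (dart) observable `𝔼[Σ_{k: γ_k → γ_{k+1} is the dart of (v,f)} e^{-(i/3)W_k}]`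
of the exploration path `γ = medialExploration (Λ δ) ω` of critical bond percolation on `δℤ²`
(`= Parafermion.bondDartObservable (Λ δ) δ (1/3) (v,f)` of `DartPhase.lean`,
`cornerObs_eq_bondDartObservable`).

## Verdict (cycle 1): RESISTS — no refutation; three hypotheses certified load-bearing

A Lean refutation `¬ EdgePrecompact` would need a rigorous LOWER bound
`‖E_{δ_k}(v_k,f_k)‖ ≥ C_k δ_k^{1/3}`, `C_k → ∞`, at bulk corners of some admissible family — i.e.
rigorous control from below of a critical bond-`ℤ²` observable in the scaling limit. No such tool
exists (even the phase-free variant needs the two-arm exponent of bond-`ℤ²` to be `< 1/3`, known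
only on the triangular lattice), and every cheap mechanism makes `E_δ` SMALLER, not larger (F1).
Physically (i) sits exactly at the CFT order `δ^{2 - 7/4}·δ^{κσ²/8} = δ^{1/4 + 1/12} = δ^{1/3}`
(F5 confirms the three exponents numerically), and (ii) asks no more than continuity of the
conjectural limit `c·(φ')^{1/3}` restricted to one travel class.

## Findings index (every `theorem` in this file is sorry-free; `lean check` rc 0, 0 warnings)

* **F1 (read-back / junk hunt — nothing bites).** `winding` is the alias of `Polyline.winding`
  (sum of `Complex.arg` turnings; medial steps turn by `±π/2` exactly, `ExplorationWinding.lean`);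
  at most one position contributes per corner (`card_passages_le_one`), so `|integrand| ≤ 1` and
  the integral is a genuine expectation (measurability: refuter g43-14, item 11269). The arcs of
  `Λ δ` are arbitrary sets, but `zdArcA/B ⊆ zdBoundary`, which lies within `2δ` of `frontier D`:
  boundary conditions can never be planted in the bulk, and `K` compact in the open carrier has
  `dist(K, ∂D) > 0`. Degenerate arcs (`a_δ ~ b_δ`, marks wandering with `δ`, no Hausdorff
  convergence required) only SHRINK `|E_δ|` on `K` (boundary one-arm factor), and wandering marks
  keep `{(φ'_{a,b})^{1/3}|_K} ∪ {0}` compact, so neither (i) nor (ii) is endangered. All filters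
  are `∀ᶠ δ in 𝓝[>] 0` (the 0772 lesson — no large-`δ` loophole); `C` may depend on `(D, Λ, K)`;
  `η` is chosen before `δ` (uniform equicontinuity, as intended); `K = ∅` / `K` missing the
  largest component give trivial truths. Thin necks / rough Jordan boundaries only affect which
  sites belong to `Ω_δ`, never the b.c. near `K`.
* **F2 (a) LOAD-BEARING: the interiority/compactness of `K`** — PROVED. At the start corner `c₀`
  (source edge `e_a`; `DiscreteDobrushin.existsUnique_startCorner`) the passage functional is `1`
  on EVERY configuration (`passagePhase_startCorner`: first dart, traversed once, zero winding), so
  `cornerObs (Λ δ) δ c₀ = 1` (`cornerObs_startCorner`) while `δ·c₀.1 ∈ D.carrier`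
  (`meshPoint_mem_of_isStartCorner`). Hence clause (i) with `K := D.carrier` fails for EVERY
  admissible family (`bound_fails_on_whole_domain`), `¬ EdgePrecompactWithoutCompact` given one
  family (`not_edgePrecompactWithoutCompact`, `…_of_familyExists` from the route's own support
  item `DiscretisationFamilyExists`, stmt-9644). Quantitatively `sup_{δv ∈ D} ‖E_δ‖ = 1` at every
  mesh: the constant `C(K)` must blow up as `K ↑ D` (CFT: `≍ dist(K,∂D)^{-1/3}`).
  **(a2) `(Λ δ).Ω = D.carrier`** — PROVED load-bearing (`not_edgePrecompactWithoutDomainEq`, given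
  one admissible family on a compactly contained sub-region: `K := closure Ω'` holds its start
  corners). **(a3) `(Λ δ).δ = δ`** — PROVED load-bearing (`not_edgePrecompactWithoutMeshEq`, given
  ONE admissible datum on a domain containing `0`: the constant family's fixed start corner `x₁`
  has `δ·x₁ → 0 ∈ K`). **Admissibility** — NOT load-bearing for truth (without it
  `medialExploration` may be the junk `[]`, `E_δ = 0`), only for meaning. **"Same class" in (ii)**
  — MC (F5): asymptotically unnecessary, the four classes align on `u = (1,1,1,1)` with defect
  `≍ δ^{1/4}·|E_δ| = o(δ^{1/3})`, so the cross-class version of (ii) is expected TRUE as well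
  (information for provers; it is `EdgeCoherence`, 11385, with trivial character). **Exponent
  `1/3`** — sharp (F5: measured `0.331`); `1/3 + ε'` would be false if the limit is non-degenerate,
  `1/4` is the trivial two-arm envelope; neither direction is provable on bond-`ℤ²` today.
* **F3 (b) TIGHTNESS of the trivial envelope.** `‖E_δ(v,f)‖ ≤ 1` for all data, all corners
  (`norm_cornerObs_le_one'`, library; `norm_cornerObs_le_one` for admissible data via orbit
  injectivity), with equality at `c₀` (F2): clause (i) with exponent `0` is trivially true — the
  whole content of (i) is the RATE.
* **F4 (c′) EXACT LATTICE STRUCTURE of the phase.** Along the exploration orbit the `k`-th dart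
  carries the twelfth root of unity `exp(-iπ M_k/6)`, `M_k = Σ_{i<k} turnSign` (`passagePhase_cornerOrbit`),
  and its travel class is `class(c₀) + M_k (mod 4)` (`cornerOrbit_snd_modEq`); so every value of
  the integrand is `0` or `e^{-iπ m/6}` with `m ≡ class - class(c₀) (mod 4)`
  (`passagePhase_mem_twelfth_roots`): per class only a rotated copy of the cube roots of unity
  occurs, `E_δ(v,f_j) ∈ e^{-iπ(j-j₀)/6}·conv{1, e^{∓2πi/3}}·[0,1]`. Consequence (finite Fourier
  inversion on `ℤ/4`, recorded for 11385/11388): with `A_q(v) := Σ_{j} i^{q(j-j₀)} E_δ(v,f_j)` =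
  the spin-`(1/3 - q)` dart observable summed over the four corners at `v` (`q = 0,1,2,3`, spins
  `1/3, -2/3, -5/3, -8/3`; termwise identity PROVED pointwise in `ω` and integrated:
  `dartPhaseSum_spin_shift`, `bondDartObservable_spin_shift`, section (c″)), one has EXACTLY
  `E_δ(v,f_j) = ¼ Σ_q (-i)^{q(j-j₀)} A_q(v)` (PROVED: `cornerObs_eq_fourier_inversion`, with
  `A_q(v) = Σ_{j'} bondDartObservable E δ (1/3 - q) (v, f_{j'})`); hence
  `EdgeCoherence` with the trivial character `u = (1,1,1,1)` ⇔ `A_1, A_2, A_3 = o(δ^{1/3})`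
  locally uniformly (CFT: `A_q ≍ δ^{1/4 + 3σ_q²/4}` minimised over `σ_q + 4ℤ`: `δ^{7/12}, δ^{7/3},
  δ^{19/12}`, i.e. relative sizes `δ^{1/4}, δ^{2}, δ^{5/4}`), and a non-trivial character would
  mean that a HIGHER twist decays slower than spin `1/3` — physically absurd, numerically excluded
  (F5). `j₀ = class(c₀)` depends on the datum, which is harmless for the projective statement.
* **F5 MONTE-CARLO — DONE (kit jobs j013248 sides `n = 64,128,256`, j013249 `512`, j013250 `1024`,
  j013251 `2048`, j013252 corners `n = 64,128,256`; 152 751 / 85 359 / 44 004 / 20 672 / 6 900 / 4 248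
  and 56 958 / 29 991 / 16 416 samples; script `mc/main.py`, per-job `summary.txt`/`results.json` and
  the consolidated table `MC_EdgePrecompact_summary.md` attached to the item).** Dobrushin box
  `{0..n}²` = the H21 discretisation (`bcBondConfig`) of an open square at mesh `1/n`; "sides": `A`
  = right half of the boundary (marks at side midpoints, start class `j₀ = 2`); "corners": `A` =
  bottom + right sides (diagonal interface, `j₀ = 1`); every sampled path exited at the predicted
  `A–B` edge. Class-summed window means over the central half, sides, `n = 64 … 2048`:
  `|Ē| = .17730, .14110, .11215, .08891, .06988, .05601` ∝ `n^{-0.3340 ± 0.0015}` (CFT `-1/3`);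
  `P(corner ∈ γ) = .28502 … .12006` ∝ `n^{-0.2507 ± 0.0013}` (CFT `-1/4`); phase ratio
  `|Ē|/P = .6221, .5871, .5534, .5234, .4928, .4665` ∝ `n^{-0.0833 ± 0.0004}` (CFT `-1/12`): over a
  factor `32` in mesh clause (i)'s envelope `δ^{1/3}` is numerically EXACT — the winding phase does
  cancel, at precisely the rate `δ^{1/12}`, and not faster. Global phase `arg Ē = 15.0° ± 0.2°`
  (`π/12`) at every mesh. Clause (ii): sublattice splits of the same-class window mean
  (`x+y mod 2 | x mod 2 | x mod 3`, relative) fall from `7.8e-5 | 3.6e-3 | 2.4e-3` (`n = 64`) to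
  `1.4e-5 | 1.8e-4 | 1.9e-4` (`n = 2048`), i.e. `O(1/n)` = the macroscopic gradient across one
  lattice spacing — NO staggered lattice-scale component (the planner's flagged risk for (ii) does
  not materialise); subwindow profiles are smooth. `EdgeCoherence` (11385): `|A_1|/|A_0| = .2333,
  .1963, .1643, .1389, .1160, .0980 = (0.659 ± 0.002)·n^{-1/4}` (fitted `-0.2507 ± 0.0010`, F4's
  heuristic `-1/4`), `|A_2|/|A_0|, |A_3|/|A_0| ≤ 3·10⁻⁴`; class ratios `|u_1/u_0| = 1.378 → 1.147`,
  `arg(u_3/u_0) = -22.1° → -8.5°` relax to the trivial character like `n^{-1/4}`, spatial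
  non-uniformity of the projective alignment `9.0% → 3.3%`. Corners geometry: `|Ē|` slope `-0.3334`,
  `P` `-0.248`, ratio `-0.0854`, `|A_1|/|A_0| = .2345, .1969, .1643` — the sides numbers to `< 1%`
  (`0.5%` for the Fourier defect), only `arg Ē = 0°` differs (start-class shift, F4): the bulk
  numbers are shape-independent.
* **F6 WHY IT RESISTS (for the record).** (i) is an UPPER bound at the conjectured sharp order and
  (ii) a regularity statement; refuting either needs lower bounds on `|E_δ|` or on its oscillation
  in the bulk as `δ → 0`, i.e. (at least) `α₂ < 1/3` for bond-`ℤ²` plus non-cancellation of the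
  winding phase — both beyond current rigorous reach (arm exponents of bond-`ℤ²` are unknown; the
  tree has no two-arm lower bound of that strength). Every formal degree of freedom of the
  statement (junk values, degenerate data, filters) was checked (F1) and is either harmless or a
  stated hypothesis whose necessity is now certified (F2).
* **F7 LITERATURE / BARRIERS.** Negatives index (`ledger negatives`): nothing on dart observables
  (0772 = large-`δ` tightness loophole, absent here). Barriers `FKParafermionicHalfCauchyRiemann`,
  `ParafermionicHalfCauchyRiemann`, `SmirnovTriangularOnly` constrain PROOF techniques for (i)/(ii)
  (no s-holomorphic primitive at `q = 1`, half of discrete CR only), not their truth. Print: DCS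
  2012 Conj. 8.7 / DC 2012 p. 8 expect exactly the `δ^{σ}` normalisation; no claim of failure of
  precompactness for `q = 1` found (grounder g20-17's reading list on the item; searchd was
  unavailable during this cycle — retried searches are logged in NOTES.md).

* **F8 (ii) IS TRANSLATION-STABILITY IN THE DOMAIN DATA (reformulation; where the difficulty
  sits).** Same-class corners are `ℤ²`-translates: `(v', f') = (v + h, f + h)`, `h ∈ ℤ²`,
  `|δh| < η`. Everything in `E_δ` is translation-covariant (Bernoulli measure, `meshDomain`,
  `zdBoundary`, arcs cut by distances, `medialExploration`, polyline winding), so EXACTLY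
  `E^{Λ δ}_δ(v + h, f + h) = E^{(Λ δ) - δh}_δ(v, f)`, where `(Λ δ) - δh` is the datum with `Ω`
  and both arcs shifted by `-δh` (not formalised here: pure bookkeeping, ~300 lines; recorded as
  the next positive lemma worth having). Hence (ii) ⇔ continuity, at scale `δ^{1/3}` and
  uniformly in `δ`, of the corner observable AT A FIXED CORNER under rigid lattice translations of
  `(Ω; arcs)` of size `< η`. Coupling the two explorations through the SAME configuration `ω`
  bounds the difference by `2·P[passage or winding class at (v,f) is decided inside the boundary
  strip of width η]`, which RSW-type boundary-continuity arguments make `≤ o_η(1)·P[(v,f) ∈ γ]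
  ≍ o_η(1)·δ^{1/4}` — i.e. (ii) holds UNCONDITIONALLY AT SCALE `δ^{1/4}` (modulo standard `ℤ²`
  RSW inputs), and its content at scale `δ^{1/3}` is once more the `δ^{1/12}` winding-phase
  cancellation, now conditionally on a boundary-strip event. So (i) and (ii) have the SAME
  missing ingredient; neither has an independent failure mode that a counterexample could hit.

## Briefing for the provers

* The boundary value `E_δ(c₀) = 1` (F2) is the discrete normalisation at `e_a`; the envelope is
  `1` (F3); interior decay `δ^{1/3}` is the entire content of (i).
* Work class by class with the integer winding number `M` (F4): `E_δ(v,f_j) = Σ_m e^{-iπm/6}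
  P[(v,f_j) ∈ γ, M = m]`, `m ≡ j - j₀ (4)`; (ii) compares like with like.
* Do not try to drop `K ⊆ D.carrier`, `(Λ δ).Ω = D.carrier` or `(Λ δ).δ = δ` (F2); admissibility
  may be assumed at every `δ` you look at (eventually-filters).
-/

namespace Summit.CriticalPhenomena.CardyFormulaZ2.Cruxes.EdgePrecompact.Disproof

open Literature.Probability.LatticeModels Literature.Probability.Percolation
open Literature.Probability.RandomPlanarGeometry (DobrushinDomain)
open MeasureTheory Filter Topology
open Summit.CriticalPhenomena.CardyFormulaZ2.Theses.CardyComplexCone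

noncomputable section

/-- The passage functional of the corner `(v, f)` along a medial path `γ` at mesh `δ`: the
integrand of the crux's corner observable `E_δ(v,f)` (spin `1/3`, winding of the polyline
prefix ending with the dart `(cornerSource v f, cornerTarget v f)`). [folklore] -/
def passagePhase (γ : List MedialVertex) (δ : ℝ) (v f : Site 2) : ℂ :=
  ∑ k ∈ (Finset.range γ.length).filter (fun k => γ[k]? = some (cornerSource v f) ∧
      γ[k + 1]? = some (cornerTarget v f)),
    Complex.exp (-(Complex.I / 3) *
      ((Polyline.winding ((γ.map (medialPoint δ)).take (k + 2)) : ℝ) : ℂ))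

/-- The corner observable `E_δ(v,f)` of discrete Dobrushin data `E` at mesh `δ` under critical
bond percolation on `ℤ²` (the `let E` of the crux, as a named function). [folklore] -/
def cornerObs (E : DiscreteDobrushin) (δ : ℝ) (v f : Site 2) : ℂ :=
  ∫ ω, passagePhase (medialExploration E ω) δ v f ∂(bondPercolation (zdGraph 2) half)

/-- The crux, restated through `cornerObs` (definitional unfolding only). [folklore] -/
theorem edgePrecompact_iff :
    EdgePrecompact ↔ ∀ (D : DobrushinDomain) (Λ : ℝ → DiscreteDobrushin),
      (∀ δ, (Λ δ).Ω = D.carrier) → (∀ δ, (Λ δ).δ = δ) →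
      (∀ᶠ δ in 𝓝[>] (0:ℝ), (Λ δ).IsZdAdmissible) →
      ∀ K : Set ℂ, IsCompact K → K ⊆ D.carrier →
        (∃ C : ℝ, ∀ᶠ δ in 𝓝[>] (0:ℝ), ∀ v f : Site 2, IsCorner v f → meshPoint δ v ∈ K →
          ‖cornerObs (Λ δ) δ v f‖ ≤ C * δ ^ ((1:ℝ) / 3)) ∧
        (∀ ε > (0:ℝ), ∃ η > (0:ℝ), ∀ᶠ δ in 𝓝[>] (0:ℝ), ∀ v f v' f' : Site 2,
          IsCorner v f → IsCorner v' f' → f - v = f' - v' → meshPoint δ v ∈ K →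
          meshPoint δ v' ∈ K → dist (meshPoint δ v) (meshPoint δ v') < η →
          ‖cornerObs (Λ δ) δ v f - cornerObs (Λ δ) δ v' f'‖ ≤ ε * δ ^ ((1:ℝ) / 3)) :=
  Iff.rfl

/-- Polylines with at most two points do not wind. [folklore] -/
theorem winding_eq_zero_of_length_le_two : ∀ l : List ℂ, l.length ≤ 2 → Polyline.winding l = 0
  | [], _ => rfl
  | [_], _ => rfl
  | [_, _], _ => rfl
  | _ :: _ :: _ :: _, h => by simp at h

/-- **The first dart carries phase one.** For admissible Dobrushin data, the passage functional
of the start corner `c₀` (whose source edge is the `A`–`B` edge `e_a`) equals `1` on EVERY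
configuration: the exploration path traverses the dart of `c₀` exactly once, as its first dart,
with zero accumulated winding. [folklore] -/
theorem passagePhase_startCorner {E : DiscreteDobrushin} (hE : E.IsZdAdmissible)
    {c₀ : Site 2 × Fin 4} (hc₀ : E.IsStartCorner c₀) (ω : BondConfig (Site 2)) (δ : ℝ) :
    passagePhase (medialExploration E ω) δ c₀.1 (cFace c₀) = 1 := by
  classical
  have hγ : IsMedialExploration E ω (medialExploration E ω) :=
    isMedialExploration_medialExploration_holds E hE ω
  set γ := medialExploration E ω with hγdef
  have h1 : 1 < γ.length := hγ.one_lt_length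
  unfold passagePhase
  have hfilter : (Finset.range γ.length).filter (fun k => γ[k]? = some (cornerSource c₀.1 (cFace c₀)) ∧
      γ[k + 1]? = some (cornerTarget c₀.1 (cFace c₀))) = {0} := by
    rw [cornerSource_cFace, cornerTarget_cFace]
    ext k
    simp only [Finset.mem_filter, Finset.mem_range, Finset.mem_singleton]
    constructor
    · rintro ⟨-, hs, ht⟩
      obtain ⟨hk, hs⟩ := List.getElem?_eq_some_iff.1 hs
      obtain ⟨hk1, ht⟩ := List.getElem?_eq_some_iff.1 ht
      by_contra hk0
      obtain ⟨-, hs', ht'⟩ := hγ.dart_eq hE hc₀ k hk1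
      have horb : cornerOrbit (E.bcBondConfig ω) c₀ k = c₀ :=
        eq_of_cSrc_eq_of_cTgt_eq (hs'.trans hs) (ht'.trans ht)
      refine cornerOrbit_ne (ω := ω) hE hc₀ (Nat.pos_of_ne_zero hk0) (fun j hj => ?_) ?_
      · exact (hγ.dart_eq hE hc₀ j (by omega)).1
      · rw [cornerOrbit_zero, horb]
    · rintro rfl
      obtain ⟨-, hs', ht'⟩ := hγ.dart_eq hE hc₀ 0 h1
      exact ⟨by omega, by rw [List.getElem?_eq_getElem (by omega), ← hs', cornerOrbit_zero],
        by rw [List.getElem?_eq_getElem h1, ← ht', cornerOrbit_zero]⟩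
  rw [hfilter, Finset.sum_singleton,
    winding_eq_zero_of_length_le_two _ (by simp [List.length_take])]
  simp

/-- **Boundary value of the corner observable.** For admissible Dobrushin data the corner
observable at the start corner equals `1` exactly (every mesh, every domain, every arcs).
[folklore] -/
theorem cornerObs_startCorner {E : DiscreteDobrushin} (hE : E.IsZdAdmissible)
    {c₀ : Site 2 × Fin 4} (hc₀ : E.IsStartCorner c₀) (δ : ℝ) :
    cornerObs E δ c₀.1 (cFace c₀) = 1 := by
  unfold cornerObs
  simp_rw [passagePhase_startCorner hE hc₀]
  simp

/-- Admissible data have a start corner. [folklore] -/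
theorem exists_isStartCorner {E : DiscreteDobrushin} (hE : E.IsZdAdmissible) :
    ∃ c₀ : Site 2 × Fin 4, E.IsStartCorner c₀ := by
  obtain ⟨c₀, hc₀, -⟩ := DiscreteDobrushin.existsUnique_startCorner hE
  exact ⟨c₀, hc₀.1, hc₀.2.1, hc₀.2.2⟩

/-- The vertex of the start corner is a site of the discrete domain, so its mesh point lies in
`Ω`. [folklore] -/
theorem meshPoint_mem_of_isStartCorner {E : DiscreteDobrushin} {c₀ : Site 2 × Fin 4}
    (hc₀ : E.IsStartCorner c₀) : meshPoint E.δ c₀.1 ∈ E.Ω := by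
  have := meshDomain_subset_meshVertices _ _
    (E.zdBoundary_subset_meshDomain (E.zdArcA_subset_zdBoundary hc₀.mem_zdArcA))
  rwa [mem_meshVertices_iff] at this

/-! ## (a) Load-bearing analysis: the interiority of `K` -/

/-- `EdgePrecompact` clause (i) with the hypothesis "`K ⊆ D.carrier` compact" dropped, i.e. the
bound asked for ALL corners whose vertex lies in the (open) domain. [folklore] -/
def EdgePrecompactWithoutCompact : Prop :=
  ∀ (D : DobrushinDomain) (Λ : ℝ → DiscreteDobrushin), (∀ δ, (Λ δ).Ω = D.carrier) →
    (∀ δ, (Λ δ).δ = δ) → (∀ᶠ δ in 𝓝[>] (0:ℝ), (Λ δ).IsZdAdmissible) →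
    ∃ C : ℝ, ∀ᶠ δ in 𝓝[>] (0:ℝ), ∀ v f : Site 2, IsCorner v f → meshPoint δ v ∈ D.carrier →
      ‖cornerObs (Λ δ) δ v f‖ ≤ C * δ ^ ((1:ℝ) / 3)

/-- **The bound of clause (i) fails on the whole domain, for EVERY admissible family**: at the
start corner the observable is `1`, which exceeds `C δ^{1/3}` for small `δ`. Hence any proof of
(i) must use that `K` stays at positive distance from `∂D` (the constant `C = C(K)` blows up as
`K ↑ D`). [folklore] -/
theorem bound_fails_on_whole_domain (D : DobrushinDomain) (Λ : ℝ → DiscreteDobrushin)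
    (hΩ : ∀ δ, (Λ δ).Ω = D.carrier) (hδ : ∀ δ, (Λ δ).δ = δ)
    (hadm : ∀ᶠ δ in 𝓝[>] (0:ℝ), (Λ δ).IsZdAdmissible) :
    ¬ ∃ C : ℝ, ∀ᶠ δ in 𝓝[>] (0:ℝ), ∀ v f : Site 2, IsCorner v f → meshPoint δ v ∈ D.carrier →
      ‖cornerObs (Λ δ) δ v f‖ ≤ C * δ ^ ((1:ℝ) / 3) := by
  rintro ⟨C, hC⟩
  have hsmall : ∀ᶠ δ in 𝓝[>] (0:ℝ), C * δ ^ ((1:ℝ) / 3) < 1 := by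
    have h0 : Tendsto (fun δ : ℝ => δ) (𝓝[>] (0:ℝ)) (𝓝 0) :=
      tendsto_id.mono_left nhdsWithin_le_nhds
    have h1 : Tendsto (fun δ : ℝ => δ ^ ((1:ℝ) / 3)) (𝓝[>] (0:ℝ)) (𝓝 0) := by
      have := h0.rpow_const (p := (1:ℝ) / 3) (Or.inr (by norm_num))
      rwa [Real.zero_rpow (by norm_num)] at this
    have h2 : Tendsto (fun δ : ℝ => C * δ ^ ((1:ℝ) / 3)) (𝓝[>] (0:ℝ)) (𝓝 0) := by
      simpa using h1.const_mul C
    exact h2.eventually_lt_const one_pos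
  obtain ⟨δ, hδadm, hδC, hδsmall⟩ := (hadm.and (hC.and hsmall)).exists
  obtain ⟨c₀, hc₀⟩ := exists_isStartCorner hδadm
  have hmem : meshPoint δ c₀.1 ∈ D.carrier := by
    have := meshPoint_mem_of_isStartCorner hc₀
    rwa [hΩ, hδ] at this
  have := hδC c₀.1 (cFace c₀) (isCorner_cFace c₀) hmem
  rw [cornerObs_startCorner hδadm hc₀, norm_one] at this
  linarith

/-- Corollary: given ONE eventually-admissible family for ONE Dobrushin domain, the
"whole-domain" strengthening of clause (i) is false. [folklore] -/
theorem not_edgePrecompactWithoutCompact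
    (hex : ∃ (D : DobrushinDomain) (Λ : ℝ → DiscreteDobrushin), (∀ δ, (Λ δ).Ω = D.carrier) ∧
      (∀ δ, (Λ δ).δ = δ) ∧ ∀ᶠ δ in 𝓝[>] (0:ℝ), (Λ δ).IsZdAdmissible) :
    ¬ EdgePrecompactWithoutCompact := fun h => by
  obtain ⟨D, Λ, h1, h2, h3⟩ := hex
  exact bound_fails_on_whole_domain D Λ h1 h2 h3 (h D Λ h1 h2 h3)

/-- Corollary: the route's own support item `DiscretisationFamilyExists` (stmt-9644) refutes the
whole-domain strengthening. [folklore] -/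
theorem not_edgePrecompactWithoutCompact_of_familyExists (h : DiscretisationFamilyExists) :
    ¬ EdgePrecompactWithoutCompact :=
  not_edgePrecompactWithoutCompact (by
    obtain ⟨Λ, h1, h2, -, -, -, h6⟩ := h DobrushinDomain.unitDisc
    exact ⟨_, Λ, h1, h2, h6⟩)

/-! ## (b) Tightness of the trivial envelope: `‖E_δ‖ ≤ 1`, attained at the start corner -/

/-- Each term of the passage functional is unimodular. [folklore] -/
theorem norm_exp_phase (w : ℝ) : ‖Complex.exp (-(Complex.I / 3) * (w : ℂ))‖ = 1 := by
  have h : -(Complex.I / 3) * (w : ℂ) = ((-(w / 3) : ℝ) : ℂ) * Complex.I := by push_cast; ring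
  rw [h, Complex.norm_exp_ofReal_mul_I]

/-- **At most one passage.** For admissible data the exploration path traverses every dart at
most once (orbit injectivity), so at most one position `k` contributes to the passage functional
of a corner. [folklore] -/
theorem card_passages_le_one {E : DiscreteDobrushin} (hE : E.IsZdAdmissible)
    (ω : BondConfig (Site 2)) (v f : Site 2) :
    ((Finset.range (medialExploration E ω).length).filter (fun k =>
      (medialExploration E ω)[k]? = some (cornerSource v f) ∧
      (medialExploration E ω)[k + 1]? = some (cornerTarget v f))).card ≤ 1 := by
  classical
  obtain ⟨c₀, hc₀⟩ := exists_isStartCorner hE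
  have hγ : IsMedialExploration E ω (medialExploration E ω) :=
    isMedialExploration_medialExploration_holds E hE ω
  set γ := medialExploration E ω with hγdef
  -- two contributing positions carry the same dart, hence the same orbit corner
  have key : ∀ k₁ k₂, γ[k₁]? = some (cornerSource v f) → γ[k₁ + 1]? = some (cornerTarget v f) →
      γ[k₂]? = some (cornerSource v f) → γ[k₂ + 1]? = some (cornerTarget v f) → ¬ k₁ < k₂ := by
    intro k₁ k₂ hs₁ ht₁ hs₂ ht₂ hlt
    obtain ⟨hk₁', hs₁⟩ := List.getElem?_eq_some_iff.1 hs₁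
    obtain ⟨hk₁, ht₁⟩ := List.getElem?_eq_some_iff.1 ht₁
    obtain ⟨hk₂', hs₂⟩ := List.getElem?_eq_some_iff.1 hs₂
    obtain ⟨hk₂, ht₂⟩ := List.getElem?_eq_some_iff.1 ht₂
    obtain ⟨-, hs₁', ht₁'⟩ := hγ.dart_eq hE hc₀ k₁ hk₁
    obtain ⟨-, hs₂', ht₂'⟩ := hγ.dart_eq hE hc₀ k₂ hk₂
    have horb : cornerOrbit (E.bcBondConfig ω) c₀ k₁ = cornerOrbit (E.bcBondConfig ω) c₀ k₂ :=
      eq_of_cSrc_eq_of_cTgt_eq (hs₁'.trans (hs₁.trans hs₂.symm) |>.trans hs₂'.symm)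
        (ht₁'.trans (ht₁.trans ht₂.symm) |>.trans ht₂'.symm)
    exact cornerOrbit_ne (ω := ω) hE hc₀ hlt (fun j hj => (hγ.dart_eq hE hc₀ j (by omega)).1) horb
  refine Finset.card_le_one.2 fun a ha b hb => ?_
  simp only [Finset.mem_filter, Finset.mem_range] at ha hb
  rcases lt_trichotomy a b with h | h | h
  · exact absurd h (key a b ha.2.1 ha.2.2 hb.2.1 hb.2.2)
  · exact h
  · exact absurd h (key b a hb.2.1 hb.2.2 ha.2.1 ha.2.2)

/-- **The trivial envelope.** For admissible data `|passagePhase| ≤ 1` pointwise. [folklore] -/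
theorem norm_passagePhase_le_one {E : DiscreteDobrushin} (hE : E.IsZdAdmissible)
    (ω : BondConfig (Site 2)) (δ : ℝ) (v f : Site 2) :
    ‖passagePhase (medialExploration E ω) δ v f‖ ≤ 1 := by
  unfold passagePhase
  refine (norm_sum_le _ _).trans ?_
  simp only [norm_exp_phase, Finset.sum_const, nsmul_eq_mul, mul_one, Nat.cast_le_one]
  exact card_passages_le_one hE ω v f

/-- **`‖E_δ(v,f)‖ ≤ 1` for admissible data** — clause (i) with exponent `0` instead of `1/3` is
trivially true; the whole content of (i) is the RATE `δ^{1/3}` (two-arm decay `δ^{1/4}` times the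
conjectural winding-phase cancellation `δ^{1/12}`), and by `cornerObs_startCorner` the envelope
`1` is attained at the boundary. [folklore] -/
theorem norm_cornerObs_le_one {E : DiscreteDobrushin} (hE : E.IsZdAdmissible) (δ : ℝ)
    (v f : Site 2) : ‖cornerObs E δ v f‖ ≤ 1 := by
  unfold cornerObs
  refine (norm_integral_le_of_norm_le_const (C := 1) (Eventually.of_forall fun ω => ?_)).trans ?_
  · exact norm_passagePhase_le_one hE ω δ v f
  · simp

/-! ## (c′) Exact lattice structure of the phase: twelfth roots of unity, class ≡ winding mod 4

Bridge to the library vocabulary (`DartPhase.lean`: `dartPhaseSum`, `bondDartObservable`) and the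
closed form of the integrand along the exploration orbit (`ExplorationWinding.lean`): at the `k`-th
dart the accumulated winding is `(π/2)·M_k`, `M_k = Σ_{i<k} turnSign` (left turns `+1`, right turns
`-1`), so every contributing phase is the twelfth root of unity `exp(-iπ M_k/6)`, and the travel
class of the `k`-th dart is `class(c₀) + M_k (mod 4)`. Consequences recorded in the findings:
per class only three phase values occur (a rotated copy of the cube roots of unity), and the class
vector of `EdgeCoherence` is the `ℤ/4`-Fourier transform of the spin-`(1/3 - q)` observables. -/

/-- The work file's `passagePhase` is the library's spin-`1/3` dart phase sum. [folklore] -/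
theorem passagePhase_eq_dartPhaseSum (γ : List MedialVertex) (δ : ℝ) (v f : Site 2) :
    passagePhase γ δ v f = Parafermion.dartPhaseSum γ δ (1 / 3) (v, f) := by
  unfold passagePhase Parafermion.dartPhaseSum
  refine Finset.sum_congr rfl fun k _ => ?_
  congr 1
  push_cast
  ring

/-- The work file's `cornerObs` is the library's `bondDartObservable` at spin `1/3`. [folklore] -/
theorem cornerObs_eq_bondDartObservable (E : DiscreteDobrushin) (δ : ℝ) (v f : Site 2) :
    cornerObs E δ v f = Parafermion.bondDartObservable E δ (1 / 3) (v, f) := by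
  unfold cornerObs Parafermion.bondDartObservable
  simp_rw [passagePhase_eq_dartPhaseSum]

/-- The envelope `‖E_δ‖ ≤ 1` for ALL Dobrushin data (library version, no admissibility needed:
`medialExploration` is `[]` or a path repeating no dart). [folklore] -/
theorem norm_cornerObs_le_one' (E : DiscreteDobrushin) (δ : ℝ) (v f : Site 2) :
    ‖cornerObs E δ v f‖ ≤ 1 := by
  rw [cornerObs_eq_bondDartObservable]
  exact Parafermion.norm_bondDartObservable_le_one E δ (1 / 3) (v, f)

/-- **Travel class ≡ winding number (mod 4).** Along the orbit of the successor map the face index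
(travel class) of the `k`-th corner is the start class plus the signed number of turns so far:
each left turn (`turnSign = 1`) advances the class by `1`, each right turn (`turnSign = -1`) by
`3 ≡ -1`. [folklore] -/
theorem cornerOrbit_snd_modEq (β : BondConfig (Site 2)) (c₀ : Site 2 × Fin 4) (k : ℕ) :
    (((cornerOrbit β c₀ k).2 : ℕ) : ℤ) ≡
      ((c₀.2 : ℕ) : ℤ) + ∑ i ∈ Finset.range k, turnSign β (cornerOrbit β c₀ i) [ZMOD 4] := by
  induction k with
  | zero => simp [cornerOrbit_zero']
  | succ k ih =>
    rw [Finset.sum_range_succ, ← add_assoc]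
    have step : (((cornerOrbit β c₀ (k + 1)).2 : ℕ) : ℤ) ≡
        (((cornerOrbit β c₀ k).2 : ℕ) : ℤ) + turnSign β (cornerOrbit β c₀ k) [ZMOD 4] := by
      show (((nextCorner β (cornerOrbit β c₀ k)).2 : ℕ) : ℤ) ≡ _ [ZMOD 4]
      have hlt := (cornerOrbit β c₀ k).2.isLt
      unfold turnSign
      have h3 : ((3 : Fin 4) : ℕ) = 3 := rfl
      have h1 : ((1 : Fin 4) : ℕ) = 1 := rfl
      by_cases h : cTgt (cornerOrbit β c₀ k) ∈ β
      · rw [nextCorner_of_mem h, if_pos h]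
        simp only [Fin.val_add, h3]
        unfold Int.ModEq
        push_cast
        omega
      · rw [nextCorner_of_not_mem h, if_neg h]
        simp only [Fin.val_add, h1]
        unfold Int.ModEq
        push_cast
        omega
    exact step.trans (ih.add_right _)

/-- **Closed form of the integrand along the orbit.** For admissible data, start corner `c₀`,
exit index `N` and `k < N`, the passage functional of the `k`-th orbit corner is the twelfth root
of unity `exp(-iπ M_k / 6)`, `M_k = Σ_{i<k} turnSign` the signed number of turns (the polyline
winding up to the `k`-th dart is `(π/2) M_k`, `ExplorationWinding.winding_orbitPts`); mesh
`δ ≠ 0`. [folklore] -/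
theorem passagePhase_cornerOrbit {E : DiscreteDobrushin} (hE : E.IsZdAdmissible)
    {c₀ : Site 2 × Fin 4} (hc₀ : E.IsStartCorner c₀) (ω : BondConfig (Site 2)) {δ : ℝ} (hδ : δ ≠ 0)
    {N : ℕ} (hN : ¬ E.IsInnerFace (cFace (cornerOrbit (E.bcBondConfig ω) c₀ N)))
    (hlt : ∀ k < N, E.IsInnerFace (cFace (cornerOrbit (E.bcBondConfig ω) c₀ k))) {k : ℕ} (hk : k < N) :
    passagePhase (medialExploration E ω) δ (cornerOrbit (E.bcBondConfig ω) c₀ k).1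
        (cFace (cornerOrbit (E.bcBondConfig ω) c₀ k)) =
      Complex.exp (-(Complex.I * Real.pi / 6) *
        ((∑ i ∈ Finset.range k, turnSign (E.bcBondConfig ω) (cornerOrbit (E.bcBondConfig ω) c₀ i) : ℤ) : ℂ)) := by
  classical
  have hγ : IsMedialExploration E ω (medialExploration E ω) :=
    isMedialExploration_medialExploration_holds E hE ω
  have heq : medialExploration E ω = explorationList (E.bcBondConfig ω) c₀ N :=
    hγ.eq_explorationList hE hc₀ hN hlt
  have hlen : (medialExploration E ω).length = N + 1 := by rw [heq, length_explorationList]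
  have hgk : (medialExploration E ω)[k]? = some (cSrc (cornerOrbit (E.bcBondConfig ω) c₀ k)) := by
    rw [List.getElem?_eq_some_iff]
    refine ⟨by omega, ?_⟩
    exact ((hγ.dart_eq hE hc₀ k (by omega)).2.1).symm
  have hgk1 : (medialExploration E ω)[k + 1]? = some (cTgt (cornerOrbit (E.bcBondConfig ω) c₀ k)) := by
    rw [List.getElem?_eq_some_iff]
    refine ⟨by omega, ?_⟩
    exact ((hγ.dart_eq hE hc₀ k (by omega)).2.2).symm
  have hmem : k ∈ (Finset.range (medialExploration E ω).length).filter (fun j =>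
      (medialExploration E ω)[j]? =
          some (cornerSource (cornerOrbit (E.bcBondConfig ω) c₀ k).1 (cFace (cornerOrbit (E.bcBondConfig ω) c₀ k))) ∧
      (medialExploration E ω)[j + 1]? =
          some (cornerTarget (cornerOrbit (E.bcBondConfig ω) c₀ k).1 (cFace (cornerOrbit (E.bcBondConfig ω) c₀ k)))) := by
    rw [Finset.mem_filter, Finset.mem_range, cornerSource_cFace, cornerTarget_cFace]
    exact ⟨by omega, hgk, hgk1⟩
  have hfilter : (Finset.range (medialExploration E ω).length).filter (fun j =>
      (medialExploration E ω)[j]? =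
          some (cornerSource (cornerOrbit (E.bcBondConfig ω) c₀ k).1 (cFace (cornerOrbit (E.bcBondConfig ω) c₀ k))) ∧
      (medialExploration E ω)[j + 1]? =
          some (cornerTarget (cornerOrbit (E.bcBondConfig ω) c₀ k).1 (cFace (cornerOrbit (E.bcBondConfig ω) c₀ k))))
      = {k} :=
    Finset.eq_singleton_iff_unique_mem.2 ⟨hmem, fun j hj =>
      Finset.card_le_one.1 (card_passages_le_one hE ω _ _) j hj k hmem⟩
  unfold passagePhase
  rw [hfilter, Finset.sum_singleton, heq, map_medialPoint_explorationList,
    take_orbitPts δ c₀ (show k + 1 ≤ N by omega), Polyline.winding_eq_winding, winding_orbitPts hδ,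
    Nat.add_sub_cancel, sum_turnOf_eq]
  congr 1
  push_cast
  ring

/-- **Only twelfth roots of unity occur, three per class.** Every value of the passage functional
of an admissible datum at mesh `δ ≠ 0` is `0` or `exp(-iπ m/6)` for an integer `m` congruent mod `4`
to (class of the corner) − (class of the start corner); in particular, within one travel class the
phases range over a rotated copy of the cube roots of unity `exp(-iπ r/6)·{1, e^{∓2πi/3}}`. This is
the exact lattice content behind `EdgeCoherence`'s class vector and behind the "same class"
restriction of `EdgePrecompact` (ii). [folklore] -/
theorem passagePhase_mem_twelfth_roots {E : DiscreteDobrushin} (hE : E.IsZdAdmissible)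
    (ω : BondConfig (Site 2)) {δ : ℝ} (hδ : δ ≠ 0) (v : Site 2) (j : Fin 4) :
    passagePhase (medialExploration E ω) δ v (faceAt v j) = 0 ∨
      ∃ (c₀ : Site 2 × Fin 4) (m : ℤ), E.IsStartCorner c₀ ∧ ((j : ℕ) : ℤ) ≡ (c₀.2 : ℕ) + m [ZMOD 4] ∧
        passagePhase (medialExploration E ω) δ v (faceAt v j) =
          Complex.exp (-(Complex.I * Real.pi / 6) * (m : ℂ)) := by
  classical
  obtain ⟨c₀, hc₀⟩ := exists_isStartCorner hE
  set β := E.bcBondConfig ω with hβ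
  have hex := exists_not_isInnerFace_cornerOrbit (ω := ω) hE hc₀
  have hlt : ∀ k < Nat.find hex, E.IsInnerFace (cFace (cornerOrbit β c₀ k)) :=
    fun k hk => not_not.1 (Nat.find_min hex hk)
  have hγ : IsMedialExploration E ω (medialExploration E ω) :=
    isMedialExploration_medialExploration_holds E hE ω
  have heq : medialExploration E ω = explorationList β c₀ (Nat.find hex) :=
    hγ.eq_explorationList hE hc₀ (Nat.find_spec hex) hlt
  by_cases hzero : passagePhase (medialExploration E ω) δ v (faceAt v j) = 0
  · exact Or.inl hzero
  · right
    -- a contributing position `k` exists; its corner is the `k`-th orbit corner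
    have hne : ((Finset.range (medialExploration E ω).length).filter (fun k =>
        (medialExploration E ω)[k]? = some (cornerSource v (faceAt v j)) ∧
        (medialExploration E ω)[k + 1]? = some (cornerTarget v (faceAt v j)))).Nonempty := by
      by_contra h
      rw [Finset.not_nonempty_iff_eq_empty] at h
      exact hzero (by unfold passagePhase; rw [h, Finset.sum_empty])
    obtain ⟨k, hk⟩ := hne
    rw [Finset.mem_filter, Finset.mem_range] at hk
    obtain ⟨hkl, hs, ht⟩ := hk
    obtain ⟨hk1, ht'⟩ := List.getElem?_eq_some_iff.1 ht
    obtain ⟨hk0, hs'⟩ := List.getElem?_eq_some_iff.1 hs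
    have hkN : k < Nat.find hex := by
      have : (medialExploration E ω).length = Nat.find hex + 1 := by rw [heq, length_explorationList]
      omega
    obtain ⟨-, hsk, htk⟩ := hγ.dart_eq hE hc₀ k hk1
    have hcorner : (v, j) = cornerOrbit β c₀ k := by
      refine eq_of_cSrc_eq_of_cTgt_eq ?_ ?_
      · rw [hsk, hs']; exact (cornerSource_cFace (v, j)).symm
      · rw [htk, ht']; exact (cornerTarget_cFace (v, j)).symm
    refine ⟨c₀, ∑ i ∈ Finset.range k, turnSign β (cornerOrbit β c₀ i), hc₀, ?_, ?_⟩
    · have := cornerOrbit_snd_modEq β c₀ k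
      rwa [← hcorner] at this
    · have key := passagePhase_cornerOrbit hE hc₀ ω hδ (Nat.find_spec hex) hlt hkN
      rw [← hcorner] at key
      exact key

/-! ## (a2)/(a3) Load-bearing analysis: `(Λ δ).Ω = D.carrier` and `(Λ δ).δ = δ`

The same boundary mechanism shows that the two bookkeeping hypotheses tying the family to the
domain and to the mesh cannot be dropped either (conditional on the existence of ONE admissible
family on a compactly contained sub-domain, resp. ONE admissible datum on a domain containing `0`;
both exist on paper, neither is in the tree — cf. `DiscretisationFamilyExists`, stmt-9644). -/

/-- A small-`δ` limit used repeatedly: `C · δ^{1/3} < 1` eventually as `δ → 0⁺`. [folklore] -/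
theorem eventually_const_mul_rpow_third_lt_one (C : ℝ) :
    ∀ᶠ δ in 𝓝[>] (0:ℝ), C * δ ^ ((1:ℝ) / 3) < 1 := by
  have h0 : Tendsto (fun δ : ℝ => δ) (𝓝[>] (0:ℝ)) (𝓝 0) :=
    tendsto_id.mono_left nhdsWithin_le_nhds
  have h1 : Tendsto (fun δ : ℝ => δ ^ ((1:ℝ) / 3)) (𝓝[>] (0:ℝ)) (𝓝 0) := by
    have := h0.rpow_const (p := (1:ℝ) / 3) (Or.inr (by norm_num))
    rwa [Real.zero_rpow (by norm_num)] at this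
  have h2 : Tendsto (fun δ : ℝ => C * δ ^ ((1:ℝ) / 3)) (𝓝[>] (0:ℝ)) (𝓝 0) := by
    simpa using h1.const_mul C
  exact h2.eventually_lt_const one_pos

/-- `EdgePrecompact` clause (i) with the hypothesis `(Λ δ).Ω = D.carrier` dropped (the family may
discretise ANOTHER region while `K` ranges over compacts of `D`). [folklore] -/
def EdgePrecompactWithoutDomainEq : Prop :=
  ∀ (D : DobrushinDomain) (Λ : ℝ → DiscreteDobrushin), (∀ δ, (Λ δ).δ = δ) →
    (∀ᶠ δ in 𝓝[>] (0:ℝ), (Λ δ).IsZdAdmissible) →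
    ∀ K : Set ℂ, IsCompact K → K ⊆ D.carrier →
      ∃ C : ℝ, ∀ᶠ δ in 𝓝[>] (0:ℝ), ∀ v f : Site 2, IsCorner v f → meshPoint δ v ∈ K →
        ‖cornerObs (Λ δ) δ v f‖ ≤ C * δ ^ ((1:ℝ) / 3)

/-- **`(Λ δ).Ω = D.carrier` is load-bearing.** Given one eventually-admissible family `Λ'`
discretising a region `Ω'` whose closure is a compact subset of `D.carrier`, the variant without
the domain equation fails: `K := closure Ω'` contains the start corners of `Λ' δ`, where the
observable is `1`. [folklore] -/
theorem not_edgePrecompactWithoutDomainEq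
    (hex : ∃ (D : DobrushinDomain) (Ω' : Set ℂ) (Λ' : ℝ → DiscreteDobrushin),
      IsCompact (closure Ω') ∧ closure Ω' ⊆ D.carrier ∧ (∀ δ, (Λ' δ).Ω = Ω') ∧
      (∀ δ, (Λ' δ).δ = δ) ∧ ∀ᶠ δ in 𝓝[>] (0:ℝ), (Λ' δ).IsZdAdmissible) :
    ¬ EdgePrecompactWithoutDomainEq := by
  intro h
  obtain ⟨D, Ω', Λ', hK, hKD, hΩ, hδ, hadm⟩ := hex
  obtain ⟨C, hC⟩ := h D Λ' hδ hadm (closure Ω') hK hKD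
  obtain ⟨δ, hδadm, hδC, hδsmall⟩ :=
    (hadm.and (hC.and (eventually_const_mul_rpow_third_lt_one C))).exists
  obtain ⟨c₀, hc₀⟩ := exists_isStartCorner hδadm
  have hmem : meshPoint δ c₀.1 ∈ closure Ω' := by
    have := meshPoint_mem_of_isStartCorner hc₀
    rw [hΩ, hδ] at this
    exact subset_closure this
  have key := hδC c₀.1 (cFace c₀) (isCorner_cFace c₀) hmem
  rw [cornerObs_startCorner hδadm hc₀, norm_one] at key
  linarith

/-- `EdgePrecompact` clause (i) with the hypothesis `(Λ δ).δ = δ` dropped (the data may have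
their own mesh while the observable and `K` are read at scale `δ`). [folklore] -/
def EdgePrecompactWithoutMeshEq : Prop :=
  ∀ (D : DobrushinDomain) (Λ : ℝ → DiscreteDobrushin), (∀ δ, (Λ δ).Ω = D.carrier) →
    (∀ᶠ δ in 𝓝[>] (0:ℝ), (Λ δ).IsZdAdmissible) →
    ∀ K : Set ℂ, IsCompact K → K ⊆ D.carrier →
      ∃ C : ℝ, ∀ᶠ δ in 𝓝[>] (0:ℝ), ∀ v f : Site 2, IsCorner v f → meshPoint δ v ∈ K →
        ‖cornerObs (Λ δ) δ v f‖ ≤ C * δ ^ ((1:ℝ) / 3)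

/-- **`(Λ δ).δ = δ` is load-bearing.** Given ONE admissible datum `E₁` on a Dobrushin domain
containing `0`, the constant family `Λ _ := E₁` satisfies the remaining hypotheses, and the fixed
start corner `x₁` of `E₁` has `δ·x₁ → 0`, so it enters every compact neighbourhood `K` of `0`,
with observable `1 > C δ^{1/3}`. [folklore] -/
theorem not_edgePrecompactWithoutMeshEq
    (hex : ∃ (D : DobrushinDomain) (E₁ : DiscreteDobrushin),
      (0:ℂ) ∈ D.carrier ∧ E₁.Ω = D.carrier ∧ E₁.IsZdAdmissible) :
    ¬ EdgePrecompactWithoutMeshEq := by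
  intro h
  obtain ⟨D, E₁, h0, hΩ, hE₁⟩ := hex
  -- a compact ball around `0` inside the domain
  obtain ⟨r, hr, hball⟩ := Metric.isOpen_iff.1 D.isOpen 0 h0
  have hK : IsCompact (Metric.closedBall (0:ℂ) (r / 2)) := isCompact_closedBall _ _
  have hKD : Metric.closedBall (0:ℂ) (r / 2) ⊆ D.carrier :=
    (Metric.closedBall_subset_ball (by linarith)).trans hball
  obtain ⟨C, hC⟩ := h D (fun _ => E₁) (fun _ => hΩ) (Eventually.of_forall fun _ => hE₁) _ hK hKD
  obtain ⟨c₀, hc₀⟩ := exists_isStartCorner hE₁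
  -- `δ · x₁ → 0`, so the start corner's mesh point is eventually in `K`
  have hin : ∀ᶠ δ in 𝓝[>] (0:ℝ), meshPoint δ c₀.1 ∈ Metric.closedBall (0:ℂ) (r / 2) := by
    have ht : Tendsto (fun δ : ℝ => meshPoint δ c₀.1) (𝓝[>] (0:ℝ)) (𝓝 0) := by
      have hc : Continuous fun δ : ℝ => meshPoint δ c₀.1 :=
        Complex.continuous_ofReal.mul continuous_const
      have := hc.tendsto 0
      simp only [meshPoint, Complex.ofReal_zero, zero_mul] at this
      exact this.mono_left nhdsWithin_le_nhds
    exact ht (Metric.closedBall_mem_nhds _ (by linarith))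
  obtain ⟨δ, hδin, hδC, hδsmall⟩ :=
    (hin.and (hC.and (eventually_const_mul_rpow_third_lt_one C))).exists
  have key := hδC c₀.1 (cFace c₀) (isCorner_cFace c₀) hδin
  rw [cornerObs_startCorner hE₁ hc₀, norm_one] at key
  linarith

/-! ## (c″) The class character is an integer spin shift (exact identity, for 11385 / 11388)

`i^{q(j - j₀)} · (spin-1/3 phase) = (spin-(1/3 - q) phase)` term by term, because the winding number
is `≡ j - j₀ (mod 4)` (F4). Hence the `ℤ/4`-Fourier components of the class vector of `E_δ` at a
vertex are the library's dart observables `bondDartObservable E δ (1/3 - q)` summed over the four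
corners — standard objects with their own (larger) decay exponents. -/

/-- `exp(π/2 · i) = i`. [folklore] -/
theorem exp_pi_div_two_mul_I : Complex.exp (↑Real.pi / 2 * Complex.I) = Complex.I := by
  rw [Complex.exp_mul_I, Complex.cos_pi_div_two, Complex.sin_pi_div_two]
  simp

/-- Powers of `i` only depend on the exponent mod `4` (integer exponent vs natural exponent).
[folklore] -/
theorem I_zpow_eq_I_pow_of_modEq {a : ℤ} {r : ℕ} (h : a ≡ r [ZMOD 4]) :
    Complex.I ^ a = Complex.I ^ r := by
  obtain ⟨t, ht⟩ := h.symm.dvd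
  have ha : a = (r : ℤ) + 4 * t := by linarith
  rw [ha, zpow_add₀ Complex.I_ne_zero, zpow_natCast, zpow_mul, show (4 : ℤ) = ((4 : ℕ) : ℤ) from rfl,
    zpow_natCast, Complex.I_pow_four, one_zpow, mul_one]

/-- The scalar identity behind the spin shift: for an integer winding number `M ≡ r (mod 4)`,
`exp(-i(1/3 - q)·(π/2)M) = i^{q r} · exp(-(i/3)·(π/2)M)`. [folklore] -/
theorem exp_spin_shift (M : ℤ) (q r : ℕ) (h : M ≡ r [ZMOD 4]) :
    Complex.exp (-Complex.I * (((1:ℝ) / 3 - q : ℝ) : ℂ) * ((Real.pi / 2 * M : ℝ) : ℂ)) =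
      Complex.I ^ (q * r) * Complex.exp (-(Complex.I / 3) * ((Real.pi / 2 * M : ℝ) : ℂ)) := by
  have hsplit : -Complex.I * (((1:ℝ) / 3 - q : ℝ) : ℂ) * ((Real.pi / 2 * M : ℝ) : ℂ) =
      -(Complex.I / 3) * ((Real.pi / 2 * M : ℝ) : ℂ) + (((q : ℤ) * M : ℤ) : ℂ) * (↑Real.pi / 2 * Complex.I) := by
    push_cast
    ring
  rw [hsplit, Complex.exp_add, mul_comm, Complex.exp_int_mul, exp_pi_div_two_mul_I]
  congr 1
  have hmod : (q : ℤ) * M ≡ ((q * r : ℕ) : ℤ) [ZMOD 4] := by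
    push_cast
    exact h.mul_left _
  exact I_zpow_eq_I_pow_of_modEq hmod

/-- **Winding prefix in closed form** (the `rw` chain of `passagePhase_cornerOrbit`, stated with
the length of the exploration instead of the exit index): for `k + 1 < |γ|` the polyline winding up
to the `k`-th dart is `(π/2)·Σ_{i<k} turnSign`. [folklore] -/
theorem winding_prefix_eq {E : DiscreteDobrushin} (hE : E.IsZdAdmissible)
    {c₀ : Site 2 × Fin 4} (hc₀ : E.IsStartCorner c₀) (ω : BondConfig (Site 2)) {δ : ℝ} (hδ : δ ≠ 0)
    {k : ℕ} (hk : k + 1 < (medialExploration E ω).length) :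
    Polyline.winding (((medialExploration E ω).map (medialPoint δ)).take (k + 2)) =
      Real.pi / 2 * ∑ i ∈ Finset.range k, (turnSign (E.bcBondConfig ω) (cornerOrbit (E.bcBondConfig ω) c₀ i) : ℝ) := by
  classical
  have hγ : IsMedialExploration E ω (medialExploration E ω) :=
    isMedialExploration_medialExploration_holds E hE ω
  set N := (medialExploration E ω).length - 1 with hNdef
  have hlen : (medialExploration E ω).length = N + 1 := by have := hγ.one_lt_length; omega
  have hN : ¬ E.IsInnerFace (cFace (cornerOrbit (E.bcBondConfig ω) c₀ N)) := hγ.not_isInnerFace_length hE hc₀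
  have hlt : ∀ i < N, E.IsInnerFace (cFace (cornerOrbit (E.bcBondConfig ω) c₀ i)) :=
    fun i hi => (hγ.dart_eq hE hc₀ i (by omega)).1
  have heq : medialExploration E ω = explorationList (E.bcBondConfig ω) c₀ N :=
    hγ.eq_explorationList hE hc₀ hN hlt
  rw [heq, map_medialPoint_explorationList, take_orbitPts δ c₀ (show k + 1 ≤ N by omega),
    Polyline.winding_eq_winding, winding_orbitPts hδ, Nat.add_sub_cancel, sum_turnOf_eq]

/-- A contributing position belongs to the orbit corner it names: if `γ[k] → γ[k+1]` is the dart
of the coded corner `(v, j)` then `(v, j)` is the `k`-th orbit corner. [folklore] -/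
theorem eq_cornerOrbit_of_dart {E : DiscreteDobrushin} (hE : E.IsZdAdmissible)
    {c₀ : Site 2 × Fin 4} (hc₀ : E.IsStartCorner c₀) (ω : BondConfig (Site 2)) {v : Site 2} {j : Fin 4}
    {k : ℕ} (hs : (medialExploration E ω)[k]? = some (cornerSource v (faceAt v j)))
    (ht : (medialExploration E ω)[k + 1]? = some (cornerTarget v (faceAt v j))) :
    ∃ _ : k + 1 < (medialExploration E ω).length, (v, j) = cornerOrbit (E.bcBondConfig ω) c₀ k := by
  have hγ : IsMedialExploration E ω (medialExploration E ω) :=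
    isMedialExploration_medialExploration_holds E hE ω
  obtain ⟨hk1, ht'⟩ := List.getElem?_eq_some_iff.1 ht
  obtain ⟨hk0, hs'⟩ := List.getElem?_eq_some_iff.1 hs
  obtain ⟨-, hsk, htk⟩ := hγ.dart_eq hE hc₀ k hk1
  refine ⟨hk1, eq_of_cSrc_eq_of_cTgt_eq ?_ ?_⟩
  · rw [hsk, hs']; exact (cornerSource_cFace (v, j)).symm
  · rw [htk, ht']; exact (cornerTarget_cFace (v, j)).symm

/-- **Class character = integer spin shift (pointwise in `ω`).** For admissible data with start
corner `c₀`, mesh `δ ≠ 0`, every vertex `v`, class `j` and `q : ℕ`: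
`dartPhaseSum γ δ (1/3 - q) (v, f_j) = i^{q·(j - j₀)} · passagePhase γ δ v f_j`, `j₀ = class(c₀)`,
`f_j = faceAt v j`. Summing over `j` and integrating: the `q`-th `ℤ/4`-Fourier component of the
class vector `(E_δ(v,f_j))_j` is the spin-`(1/3 - q)` dart observable summed over the corners at
`v`. [folklore] -/
theorem dartPhaseSum_spin_shift {E : DiscreteDobrushin} (hE : E.IsZdAdmissible)
    {c₀ : Site 2 × Fin 4} (hc₀ : E.IsStartCorner c₀) (ω : BondConfig (Site 2)) {δ : ℝ} (hδ : δ ≠ 0)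
    (v : Site 2) (j : Fin 4) (q : ℕ) :
    Parafermion.dartPhaseSum (medialExploration E ω) δ ((1:ℝ) / 3 - q) (v, faceAt v j) =
      Complex.I ^ (q * ((j - c₀.2 : Fin 4) : ℕ)) * passagePhase (medialExploration E ω) δ v (faceAt v j) := by
  classical
  unfold Parafermion.dartPhaseSum passagePhase
  dsimp only
  rw [Finset.mul_sum]
  refine Finset.sum_congr rfl fun k hk => ?_
  rw [Finset.mem_filter] at hk
  obtain ⟨-, hs, ht⟩ := hk
  obtain ⟨hk1, hcorner⟩ := eq_cornerOrbit_of_dart hE hc₀ ω hs ht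
  have hmod := cornerOrbit_snd_modEq (E.bcBondConfig ω) c₀ k
  rw [← hcorner] at hmod
  dsimp only at hmod
  set M : ℤ := ∑ i ∈ Finset.range k, turnSign (E.bcBondConfig ω) (cornerOrbit (E.bcBondConfig ω) c₀ i) with hM
  have hW : Polyline.winding (((medialExploration E ω).map (medialPoint δ)).take (k + 2)) = Real.pi / 2 * (M : ℝ) := by
    rw [winding_prefix_eq hE hc₀ ω hδ hk1, hM]
    push_cast
    rfl
  have hr : M ≡ (((j - c₀.2 : Fin 4) : ℕ) : ℤ) [ZMOD 4] := by
    have hj := j.isLt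
    have hj₀ := c₀.2.isLt
    rw [Fin.val_sub]
    unfold Int.ModEq at hmod ⊢
    push_cast
    omega
  rw [hW]
  exact exp_spin_shift M q _ hr

/-- **Integrated spin shift.** For admissible data with start corner `c₀` and mesh `δ ≠ 0`, the
library's dart observable at spin `1/3 - q` is the class character times the crux's corner
observable: `bondDartObservable E δ (1/3 - q) (v, f_j) = i^{q(j - j₀)} · E_δ(v, f_j)` (no
measurability needed: a constant factors out of any Bochner integral). Consequently the `q`-th
`ℤ/4`-Fourier component `A_q(v) = Σ_j i^{q(j-j₀)} E_δ(v,f_j)` of the class vector is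
`Σ_j bondDartObservable E δ (1/3 - q) (v, f_j)`, and by character orthogonality
`E_δ(v,f_j) = ¼ Σ_q (-i)^{q(j-j₀)} A_q(v)` (finite Fourier inversion, not formalised).
[folklore] -/
theorem bondDartObservable_spin_shift {E : DiscreteDobrushin} (hE : E.IsZdAdmissible)
    {c₀ : Site 2 × Fin 4} (hc₀ : E.IsStartCorner c₀) {δ : ℝ} (hδ : δ ≠ 0)
    (v : Site 2) (j : Fin 4) (q : ℕ) :
    Parafermion.bondDartObservable E δ ((1:ℝ) / 3 - q) (v, faceAt v j) =
      Complex.I ^ (q * ((j - c₀.2 : Fin 4) : ℕ)) * cornerObs E δ v (faceAt v j) := by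
  unfold Parafermion.bondDartObservable cornerObs
  simp_rw [dartPhaseSum_spin_shift hE hc₀ _ hδ]
  exact integral_const_mul _ _

/-- The `q`-th Fourier component of the class vector at a vertex is a sum of four library dart
observables at spin `1/3 - q`. [folklore] -/
theorem fourierComponent_eq_sum_bondDartObservable {E : DiscreteDobrushin} (hE : E.IsZdAdmissible)
    {c₀ : Site 2 × Fin 4} (hc₀ : E.IsStartCorner c₀) {δ : ℝ} (hδ : δ ≠ 0) (v : Site 2) (q : ℕ) :
    ∑ j : Fin 4, Complex.I ^ (q * ((j - c₀.2 : Fin 4) : ℕ)) * cornerObs E δ v (faceAt v j) =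
      ∑ j : Fin 4, Parafermion.bondDartObservable E δ ((1:ℝ) / 3 - q) (v, faceAt v j) :=
  Finset.sum_congr rfl fun j _ => (bondDartObservable_spin_shift hE hc₀ hδ v j q).symm

/-- The crux phrased with the library observable `Parafermion.bondDartObservable (Λ δ) δ (1/3)`
(so that provers may use the `DartPhase.lean` API directly). [folklore] -/
theorem edgePrecompact_iff_bondDartObservable :
    EdgePrecompact ↔ ∀ (D : DobrushinDomain) (Λ : ℝ → DiscreteDobrushin),
      (∀ δ, (Λ δ).Ω = D.carrier) → (∀ δ, (Λ δ).δ = δ) →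
      (∀ᶠ δ in 𝓝[>] (0:ℝ), (Λ δ).IsZdAdmissible) →
      ∀ K : Set ℂ, IsCompact K → K ⊆ D.carrier →
        (∃ C : ℝ, ∀ᶠ δ in 𝓝[>] (0:ℝ), ∀ v f : Site 2, IsCorner v f → meshPoint δ v ∈ K →
          ‖Parafermion.bondDartObservable (Λ δ) δ (1 / 3) (v, f)‖ ≤ C * δ ^ ((1:ℝ) / 3)) ∧
        (∀ ε > (0:ℝ), ∃ η > (0:ℝ), ∀ᶠ δ in 𝓝[>] (0:ℝ), ∀ v f v' f' : Site 2,
          IsCorner v f → IsCorner v' f' → f - v = f' - v' → meshPoint δ v ∈ K →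
          meshPoint δ v' ∈ K → dist (meshPoint δ v) (meshPoint δ v') < η →
          ‖Parafermion.bondDartObservable (Λ δ) δ (1 / 3) (v, f) -
            Parafermion.bondDartObservable (Λ δ) δ (1 / 3) (v', f')‖ ≤ ε * δ ^ ((1:ℝ) / 3)) := by
  rw [edgePrecompact_iff]
  simp_rw [cornerObs_eq_bondDartObservable]

set_option linter.unusedSimpArgs false in
/-- **Finite Fourier inversion on `ℤ/4`** (character orthogonality, brute force over the sixteen
cases): `e_d = ¼ Σ_q (-i)^{qd} Σ_{d'} i^{qd'} e_{d'}`. [folklore] -/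
theorem fourier_inversion_fin4 (e : Fin 4 → ℂ) {d : ℕ} (hd : d < 4) :
    e ⟨d, hd⟩ = (1 / 4) * ∑ q : Fin 4, (-Complex.I) ^ ((q : ℕ) * d) *
      ∑ d' : Fin 4, Complex.I ^ ((q : ℕ) * (d' : ℕ)) * e d' := by
  have h3 : ((3 : Fin 4) : ℕ) = 3 := rfl
  have h2 : ((2 : Fin 4) : ℕ) = 2 := rfl
  have hI3 : Complex.I ^ 3 = -Complex.I := by rw [pow_succ, Complex.I_sq]; ring
  have hmod : ∀ n : ℕ, Complex.I ^ n = Complex.I ^ (n % 4) := fun n => by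
    conv_lhs => rw [← Nat.mod_add_div n 4, pow_add, pow_mul, Complex.I_pow_four, one_pow, mul_one]
  simp only [Fin.sum_univ_four, Fin.val_zero, Fin.val_one, h2, h3]
  interval_cases d
  · have : (⟨0, hd⟩ : Fin 4) = 0 := rfl
    rw [this]; ring_nf
    simp only [hmod 18, hmod 15, hmod 12, hmod 10, hmod 9, hmod 8, hmod 7, hmod 6, hmod 5, hmod 4,
      Nat.reduceMod, pow_zero, pow_one, Complex.I_sq, hI3]
    ring_nf
  · have : (⟨1, hd⟩ : Fin 4) = 1 := rfl
    rw [this]; ring_nf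
    simp only [hmod 18, hmod 15, hmod 12, hmod 10, hmod 9, hmod 8, hmod 7, hmod 6, hmod 5, hmod 4,
      Nat.reduceMod, pow_zero, pow_one, Complex.I_sq, hI3]
    ring_nf
  · have : (⟨2, hd⟩ : Fin 4) = 2 := rfl
    rw [this]; ring_nf
    simp only [hmod 18, hmod 15, hmod 12, hmod 10, hmod 9, hmod 8, hmod 7, hmod 6, hmod 5, hmod 4,
      Nat.reduceMod, pow_zero, pow_one, Complex.I_sq, hI3]
    ring_nf
  · have : (⟨3, hd⟩ : Fin 4) = 3 := rfl
    rw [this]; ring_nf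
    simp only [hmod 18, hmod 15, hmod 12, hmod 10, hmod 9, hmod 8, hmod 7, hmod 6, hmod 5, hmod 4,
      Nat.reduceMod, pow_zero, pow_one, Complex.I_sq, hI3]
    ring_nf

/-- **The class vector is the `ℤ/4`-Fourier transform of the spin-shifted dart observables**
(the identity `E_δ(v,f_j) = ¼ Σ_q (-i)^{q(j-j₀)} A_q(v)` of the findings, now a theorem): for
admissible data with start corner `c₀`, mesh `δ ≠ 0`,
`E_δ(v, f_j) = ¼ Σ_{q<4} (-i)^{q(j-j₀)} Σ_{j'} bondDartObservable E δ (1/3 - q) (v, f_{j'})`.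
So `EdgeCoherence` (11385) with the trivial character is EXACTLY the statement that the `q = 1,2,3`
vertex-summed dart observables are `o(δ^{1/3})` locally uniformly. [folklore] -/
theorem cornerObs_eq_fourier_inversion {E : DiscreteDobrushin} (hE : E.IsZdAdmissible)
    {c₀ : Site 2 × Fin 4} (hc₀ : E.IsStartCorner c₀) {δ : ℝ} (hδ : δ ≠ 0) (v : Site 2) (j : Fin 4) :
    cornerObs E δ v (faceAt v j) = (1 / 4) * ∑ q : Fin 4,
      (-Complex.I) ^ ((q : ℕ) * ((j - c₀.2 : Fin 4) : ℕ)) *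
        ∑ j' : Fin 4, Parafermion.bondDartObservable E δ ((1:ℝ) / 3 - (q : ℕ)) (v, faceAt v j') := by
  have key := fourier_inversion_fin4 (fun d => cornerObs E δ v (faceAt v (d + c₀.2))) (j - c₀.2).isLt
  simp only [Fin.eta, sub_add_cancel] at key
  rw [key]
  congr 1
  refine Finset.sum_congr rfl fun q _ => ?_
  congr 1
  rw [← fourierComponent_eq_sum_bondDartObservable hE hc₀ hδ v (q : ℕ)]
  exact Fintype.sum_equiv (Equiv.addRight c₀.2) _ _ (fun d => by simp [add_sub_cancel_right])

end

end Summit.CriticalPhenomena.CardyFormulaZ2.Cruxes.EdgePrecompact.Disproof
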